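import Literature.Claims.NS.Karadzhov2026
import Literature.Analysis.FluidPDE.NSGalerkinTrajectory
import Literature.Analysis.FluidPDE.GalerkinFlow
import Literature.Analysis.FluidPDE.NSGalerkinZeroMode
import Literature.Analysis.FunctionSpaces.TorusSpaceTimeFields
import HarnessLib

/-!
# C174 `Karadzhov2026` — records: the LITERAL display (28) of Thm 8.2 (`Step_T82`) is false

D-0090 NS-CLAIMS SWEEP, salvage-p4 (g5); records-grade object for ADJUDICATED #159 (head
`Step_T641` UG — untouched). The RECORDED step `Literature.Claims.NS.Karadzhov2026.Step_T82` types
Thm 8.2's display (28) p.16 AS PRINTED: «sup_{0≤t≤T}‖A^{1/4}u_N(t)‖² + ν∫₀ᵀ‖A^{3/4}u_N‖² dt ≤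
‖A^{1/4}u₀‖²» — with the `sup` (hence the `t = 0` value, which already equals the right side) ADDED to
the full dissipation integral. At `t = 0` this reads `critSq u₀ + ν∫₀ᵀ crit3Sq (U s) ds ≤ critSq u₀`,
impossible for any nonzero datum (the proof's last line p.16 l.226–235 only yields
`X(t) + ν∫₀ᵗ Y ≤ X(0)` for each `t` — the TRUE face `Step_T82_energy`, discharged in
`SoloSalvageKaradzhov2026SmallData`, p558054). Witness (genuine, in class, arbitrarily small): the
one-shell divergence-free mean-zero mode `u₀ = ε·(0,0,cos 2πx₁)`-type field
`realTrigPoly (freqBall 1) c_ε` (modes `±e₁`, amplitude vector `ε e₃`), `N = 1`, the field-level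
Galerkin trajectory from `P_1 u₀ = u₀` (`Torus.exists_isGalerkinTrajectory_of_isGalerkinMode`),
and a short horizon `T = δ` on which `crit3Sq (U s) > ε²/2` by continuity.

WHAT THIS IS NOT: not a claim about NS regularity or blow-up; not a claim about any author beyond the
typed locator.
-/

noncomputable section

open MeasureTheory Set Filter Topology UnitAddTorus

-- The summit's canonical theorem namespace repeats the summit name (single-conjunct summit).
set_option linter.dupNamespace false

namespace Summit.NavierStokesRegularity.NavierStokesRegularity.Theorems.Karadzhov2026

open Literature.Analysis Literature.Analysis.FluidPDE Literature.Analysis.FunctionSpaces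
  Literature.Analysis.FunctionSpaces.Torus
open Literature.Claims.NS.Karadzhov2026
open Literature.Claims.NS.Higgins2026 (T3 E3 C3 Z3 coeff latt)
open Literature.Claims.NS.Lietz2026 (IsDatum)

/-- The unit frequency `e₁ = (1,0,0) ∈ ℤ³`. [folklore] -/
def e1 : Z3 := Pi.single 0 1

/-- `|e₁|² = 1`. [folklore] -/
theorem freqNormSq_e1 : freqNormSq e1 = 1 := by
  simp [freqNormSq, e1, Pi.single_apply]

/-- `e₁ ≠ 0`. [folklore] -/
theorem e1_ne_zero : e1 ≠ 0 := by
  intro h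
  have := congrFun h 0
  simp [e1] at this

/-- `±e₁` lie in the frequency ball of radius `1`. [folklore] -/
theorem e1_mem_freqBall : e1 ∈ freqBall (d := Fin 3) 1 := by
  rw [mem_freqBall, freqNormSq_e1]; norm_num

/-- The amplitude vector `ε e₃ ∈ ℂ³` (real entries). [folklore] -/
def amp (ε : ℝ) : C3 := ((ε : ℝ) : ℂ) • EuclideanSpace.single (2 : Fin 3) (1 : ℂ)

/-- `ε e₃` is a real vector: `conj (ε e₃) = ε e₃`. [folklore] -/
theorem conjVec_amp (ε : ℝ) : FunctionSpaces.EuclideanSpace.conjVec (amp ε) = amp ε := by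
  ext i
  simp only [FunctionSpaces.EuclideanSpace.conjVec_apply, amp, PiLp.smul_apply, smul_eq_mul, map_mul,
    Complex.conj_ofReal]
  congr 1
  by_cases hi : i = 2
  · subst hi; simp
  · simp [hi]

/-- `‖ε e₃‖ = |ε|`. [folklore] -/
theorem norm_amp (ε : ℝ) : ‖amp ε‖ = |ε| := by
  rw [amp, norm_smul, Complex.norm_real, Real.norm_eq_abs]
  simp

/-- `ε e₃ ⊥ k` for every `k` with `k 2 = 0` (in particular `±e₁`). [folklore] -/
theorem sum_mul_amp_eq_zero (ε : ℝ) {k : Z3} (hk : k 2 = 0) : ∑ j, (k j : ℂ) * amp ε j = 0 := by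
  simp [amp, hk]

/-- The coefficient vector of the witness datum on the ball of radius `1`: `ε e₃` at `±e₁`, `0`
elsewhere. [folklore] -/
def cw (ε : ℝ) : ↥(freqBall (d := Fin 3) 1) → C3 :=
  fun k => if (k : Z3) = e1 ∨ (k : Z3) = -e1 then amp ε else 0

/-- The witness coefficient vector lies in the Galerkin phase space (real, divergence free). [folklore] -/
theorem cw_mem (ε : ℝ) : cw ε ∈ galerkinSubspace (freqBall (d := Fin 3) 1) := by
  refine ⟨fun k l hkl => ?_, fun k => ?_⟩
  · -- reality: `c(−k) = conj (c k)`
    simp only [cw]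
    have hiff : ((l : Z3) = e1 ∨ (l : Z3) = -e1) ↔ ((k : Z3) = e1 ∨ (k : Z3) = -e1) := by
      rw [hkl]
      constructor
      · rintro (h | h)
        · right; rw [← h, neg_neg]
        · left; exact neg_injective (by rw [h])
      · rintro (h | h)
        · right; rw [h]
        · left; rw [h, neg_neg]
    by_cases h : (k : Z3) = e1 ∨ (k : Z3) = -e1
    · rw [if_pos (hiff.2 h), if_pos h, conjVec_amp]
    · rw [if_neg (fun h' => h (hiff.1 h')), if_neg h, FunctionSpaces.EuclideanSpace.conjVec_zero]
  · -- transversality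
    simp only [cw]
    by_cases h : (k : Z3) = e1 ∨ (k : Z3) = -e1
    · rw [if_pos h]
      refine sum_mul_amp_eq_zero ε ?_
      rcases h with h | h <;> simp [h, e1]
    · rw [if_neg h]; simp

/-- The witness datum `u₀ = realTrigPoly (freqBall 1) c̄_ε` (`= 2ε cos(2πx₁) e₃`). [folklore] -/
def datum (ε : ℝ) : T3 → E3 := realTrigPoly (freqBall 1) (coeffExt (freqBall 1) (cw ε))

/-- The witness datum is a Galerkin mode of order `1`. [folklore] -/
theorem isGalerkinMode_datum (ε : ℝ) : IsGalerkinMode 1 (datum ε) :=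
  isGalerkinMode_realTrigPoly_coeffExt (cw_mem ε)

/-- The Fourier coefficients of the witness datum. [folklore] -/
theorem coeff_datum (ε : ℝ) (k : Z3) :
    coeff (datum ε) k = if k ∈ freqBall (d := Fin 3) 1 then coeffExt (freqBall 1) (cw ε) k else 0 := by
  rw [coeff, datum, mFourierCoeff_realTrigPoly neg_mem_freqBall_of_mem
    ((cw_mem ε).1.isConjSymm_coeffExt neg_mem_freqBall_of_mem)]

/-- The coefficient at `e₁` is `ε e₃`. [folklore] -/
theorem coeff_datum_e1 (ε : ℝ) : coeff (datum ε) e1 = amp ε := by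
  rw [coeff_datum, if_pos e1_mem_freqBall, coeffExt_of_mem _ e1_mem_freqBall]
  simp [cw]

/-- The witness datum is in the print's data class (smooth, divergence free, mean zero). [folklore] -/
theorem isDatum_datum (ε : ℝ) : IsDatum (datum ε) := by
  have hm := isGalerkinMode_datum ε
  refine ⟨hm.isSmooth, hm.isDivFree, ?_⟩
  refine hasZeroMean_realTrigPoly_of neg_mem_freqBall_of_mem
    ((cw_mem ε).1.isConjSymm_coeffExt neg_mem_freqBall_of_mem) fun h0 => ?_
  rw [coeffExt_of_mem _ h0]
  simp only [cw]
  rw [if_neg]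
  rintro (h | h)
  · exact e1_ne_zero h.symm
  · exact e1_ne_zero (neg_eq_zero.1 h.symm)

/-- `critSq u₀ ≤ 2ε²` for the witness datum (only the modes `±e₁`, of weight `|k| = 1`, carry
coefficients, each of norm `|ε|`; the bound is all that is needed). [folklore] -/
theorem critSq_datum_le (ε : ℝ) : critSq (datum ε) ≤ 2 * ε ^ 2 := by
  have hS : ∀ k ∉ ({e1, -e1} : Finset Z3), latt k * ‖coeff (datum ε) k‖ ^ 2 = 0 := by
    intro k hk
    rw [coeff_datum]
    by_cases hkb : k ∈ freqBall (d := Fin 3) 1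
    · rw [if_pos hkb, coeffExt_of_mem _ hkb]
      simp only [cw]
      rw [if_neg (by simpa [Finset.mem_insert, Finset.mem_singleton] using hk), norm_zero]
      ring
    · rw [if_neg hkb, norm_zero]; ring
  rw [critSq, tsum_eq_sum (s := ({e1, -e1} : Finset Z3)) hS]
  have hne : e1 ≠ -e1 := by
    intro h
    have := congrFun h 0
    simp [e1] at this
  rw [Finset.sum_pair hne]
  have hl1 : latt e1 = 1 := by rw [latt, freqNormSq_e1, Real.sqrt_one]
  have hl2 : latt (-e1) = 1 := by rw [latt, freqNormSq_neg, freqNormSq_e1, Real.sqrt_one]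
  have hb : ∀ k : Z3, ‖coeff (datum ε) k‖ ^ 2 ≤ ε ^ 2 := by
    intro k
    rw [coeff_datum]
    by_cases hkb : k ∈ freqBall (d := Fin 3) 1
    · rw [if_pos hkb, coeffExt_of_mem _ hkb]
      simp only [cw]
      split_ifs
      · rw [norm_amp, sq_abs]
      · rw [norm_zero, zero_pow two_ne_zero]; positivity
    · rw [if_neg hkb, norm_zero, zero_pow two_ne_zero]; positivity
  rw [hl1, hl2, one_mul, one_mul]
  linarith [hb e1, hb (-e1)]

/-- For a Galerkin mode of order `N`, `crit3Sq` is the finite sum over the frequency ball. [folklore] -/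
theorem crit3Sq_eq_sum {N : ℕ} {v : T3 → E3} (hv : IsGalerkinMode N v) :
    crit3Sq v = ∑ k ∈ freqBall (d := Fin 3) N, latt k ^ 3 * ‖coeff v k‖ ^ 2 :=
  tsum_eq_sum fun k hk => by
    rw [coeff, hv.mFourierCoeff_eq_zero (not_mem_freqBall.1 hk), norm_zero]; ring

/-- Along a field-level Galerkin trajectory `crit3Sq (U s)` is continuous on `[0, ∞)`. [folklore] -/
theorem continuousOn_crit3Sq {ν : ℝ} {N : ℕ} {U : ℝ → T3 → E3}
    (hU : Torus.IsGalerkinTrajectory ν 0 N U) :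
    ContinuousOn (fun s => crit3Sq (U s)) (Ici 0) := by
  have h : ∀ s ∈ Ici (0 : ℝ), crit3Sq (U s) =
      ∑ k ∈ freqBall (d := Fin 3) N, latt k ^ 3 * ‖coeff (U s) k‖ ^ 2 :=
    fun s hs => crit3Sq_eq_sum (hU.isGalerkinMode s hs)
  refine (continuousOn_finsetSum _ fun k _ => ?_).congr h
  exact continuousOn_const.mul
    ((FunctionSpaces.Torus.continuousOn_mFourierCoeff_of_continuousOn_stLift hU.continuousOn k).norm.pow 2)

/-- A lower bound: `crit3Sq v ≥ ‖coeff v e₁‖²` for a Galerkin mode (the `e₁` term of the sum;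
`|e₁|³ = 1`). [folklore] -/
theorem norm_coeff_e1_sq_le_crit3Sq {N : ℕ} (hN : 1 ≤ N) {v : T3 → E3} (hv : IsGalerkinMode N v) :
    ‖coeff v e1‖ ^ 2 ≤ crit3Sq v := by
  rw [crit3Sq_eq_sum hv]
  have hN' : (1 : ℝ) ≤ (N : ℝ) := by exact_mod_cast hN
  have hmem : e1 ∈ freqBall (d := Fin 3) N := by
    rw [mem_freqBall, freqNormSq_e1]
    calc (1 : ℝ) = 1 * 1 := (mul_one 1).symm
      _ ≤ (N : ℝ) * N := mul_le_mul hN' hN' zero_le_one (zero_le_one.trans hN')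
      _ = (N : ℝ) ^ 2 := (sq _).symm
  have hl1 : latt e1 = 1 := by rw [latt, freqNormSq_e1, Real.sqrt_one]
  have hnn : ∀ k ∈ freqBall (d := Fin 3) N, 0 ≤ latt k ^ 3 * ‖coeff v k‖ ^ 2 := by
    intro k _
    have hk : 0 ≤ latt k := Real.sqrt_nonneg _
    positivity
  have hle := Finset.single_le_sum hnn hmem
  rw [hl1, one_pow, one_mul] at hle
  exact hle

/-- **`Step_T82` (display (28) AS PRINTED) is false.** [cite: Karadzhov2026, Thm 8.2 (28) p.16 l.130–139; proof p.16 l.226–235] -/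
theorem not_Step_T82 : ¬ Literature.Claims.NS.Karadzhov2026.Step_T82 := by
  rintro ⟨c, hc, h⟩
  -- viscosity 1, amplitude ε = c/2: `critSq u₀ ≤ 2ε² = c²/2 ≤ c²`
  set ε : ℝ := c / 2 with hε
  have hε0 : 0 < ε := by positivity
  have hsmall : critSq (datum ε) ≤ (c * 1) ^ 2 := by
    have := critSq_datum_le ε
    rw [hε] at this ⊢; nlinarith
  -- the field-level Galerkin trajectory from `P_1 u₀ = u₀`
  have hmode := isGalerkinMode_datum ε
  obtain ⟨U, hU, hU0⟩ := Torus.exists_isGalerkinTrajectory_of_isGalerkinMode (ν := 1) zero_le_one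
    (N := 1) (f := 0) (a := datum ε) MemLp.zero hmode
  have hPN : Torus.fourierTruncate 1 (datum ε) = datum ε :=
    fourierTruncate_eq_self hmode.isSmooth.continuous fun _ hk => hmode.mFourierCoeff_eq_zero hk
  have hgal : IsGalerkin 1 1 (datum ε) U := ⟨hU, by rw [hU0, hPN]⟩
  -- `crit3Sq (U s) > ε²/2` near `s = 0`
  have hcont := continuousOn_crit3Sq hU
  have h0 : ε ^ 2 ≤ crit3Sq (U 0) := by
    rw [hU0]
    have := norm_coeff_e1_sq_le_crit3Sq le_rfl hmode
    rwa [coeff_datum_e1, norm_amp, sq_abs] at this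
  have hε2 : 0 < ε ^ 2 / 2 := by positivity
  obtain ⟨δ, hδ, hnear⟩ : ∃ δ > 0, ∀ s ∈ Icc (0 : ℝ) δ, ε ^ 2 / 2 < crit3Sq (U s) := by
    have hc0 : ContinuousWithinAt (fun s => crit3Sq (U s)) (Ici 0) 0 := hcont 0 (by simp)
    have hlt : ε ^ 2 / 2 < crit3Sq (U 0) := by linarith
    have hev := hc0.eventually (lt_mem_nhds hlt)
    rw [Filter.eventually_iff, mem_nhdsWithin] at hev
    obtain ⟨o, ho, h0o, hsub⟩ := hev
    obtain ⟨r, hr, hball⟩ := Metric.isOpen_iff.1 ho 0 h0o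
    refine ⟨r / 2, by positivity, fun s hs => ?_⟩
    have hso : s ∈ o := hball (by
      rw [Metric.mem_ball, Real.dist_eq, sub_zero, abs_of_nonneg hs.1]; linarith [hs.2])
    exact hsub ⟨hso, hs.1⟩
  -- the dissipation integral on `[0, δ]` is positive
  have hint : ε ^ 2 / 2 * δ ≤ ∫ s in (0 : ℝ)..δ, crit3Sq (U s) := by
    have hci : ContinuousOn (fun s => crit3Sq (U s)) (Icc 0 δ) := hcont.mono fun s hs => hs.1
    calc ε ^ 2 / 2 * δ = ∫ _ in (0 : ℝ)..δ, ε ^ 2 / 2 := by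
          rw [intervalIntegral.integral_const]; simp [mul_comm]
      _ ≤ ∫ s in (0 : ℝ)..δ, crit3Sq (U s) := by
          refine intervalIntegral.integral_mono_on hδ.le intervalIntegrable_const
            (hci.intervalIntegrable_of_Icc hδ.le) fun s hs => (hnear s hs).le
  have hpos : 0 < ∫ s in (0 : ℝ)..δ, crit3Sq (U s) := lt_of_lt_of_le (by positivity) hint
  -- the printed display at `t = 0 ∈ [0, δ]`
  have hstep := h 1 one_pos (datum ε) (isDatum_datum ε) hsmall 1 U hgal δ hδ 0
    (left_mem_Icc.2 hδ.le)
  rw [hU0, one_mul] at hstep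
  linarith

end Summit.NavierStokesRegularity.NavierStokesRegularity.Theorems.Karadzhov2026
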